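import Summits.BirchSwinnertonDyer.BirchSwinnertonDyer.Theorems.ByReductionTypeAtTwoRankOneAtTwoOneDoorLawFirstLayerDefs
import Literature.NumberTheory.EllipticCurves.CongruenceNumber
import Literature.NumberTheory.EllipticCurves.ModularSymbolsLattice
import Literature.NumberTheory.EllipticCurves.Selmer
import Literature.NumberTheory.EllipticCurves.QuadraticTwist
import HarnessLib

/-!
# ES-33 (-es g24) — the TWIST LATTICE in the congruence number at square level, and the anatomy of the
# 2-adic modular-degree floor (sketch; crux `RankOneAtTwoBigImageOddLocal` = stmt-BirchSwinnertonDyer-23715)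

ES-33A `TwistLatticeDividesCongruenceNumber`: for a non-CM elliptic newform `f` of level `N`,
`2^{a₀(N)} ∣ r_f` with `a₀(N) = #{p odd : p² ∣ N} + [2⁴ ∣ N] + [2⁶ ∣ N]` — every quadratic character `χ` with
`cond(χ)² ∣ N` gives `f ⊗ χ ∈ S₂(Γ₀(N); ℤ)`, `f ⊗ χ ⊥ f`, `f ⊗ χ ≡ f (mod 2)` (Yazdani 2011, proof of Prop. 2.10:
ONE direction, parity), and for `k` independent characters `h = 2^{-k} Σ_{S} (-1)^{|S|} f ⊗ χ_S = 2^{-k} Σ_n a_n ∏ᵢ(1 − χᵢ(n)) qⁿ`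
is INTEGRAL with `f − (f − 2^k h) = 2^k h`, `f − 2^k h ∈ (ℤf)^⊥` — so `2^k ∣ r_f` by the tree's
`dvd_congruenceNumber_of_sub_eq_smul` (the LATTICE form is this lens's addition).  ES-33A₁ is the printed parity case.
ES-33B/C are the lens's CONJECTURES in congruence-number currency (ENGINE 33, kit job33): the Selmer–Atkin–Lehner
floor WITHOUT the `v₂(N) = 2` dip of ES-32B♯, and the dip as the Agashe–Ribet–Stein defect `v₂(r_E/m_E) = 1` at `4 ∥ N`.
Nothing here is a theorem beyond print; BSD is not proved.
-/

open scoped Classical AddSubgroup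

noncomputable section

set_option linter.dupNamespace false
set_option autoImplicit false

namespace Summit.BirchSwinnertonDyer.BirchSwinnertonDyer.Theorems.RankOneAtTwoTwistLattice

open Literature.NumberTheory.EllipticCurves Literature.NumberTheory.EllipticCurves.ModularForms WeierstrassCurve

/-- `#{p odd prime : p² ∣ N}` — the odd primes at which a quadratic twist of conductor `p` keeps level `N`
(Shimura 1971 Prop. 3.64: `f ⊗ χ ∈ S₂(Γ₀(lcm(N, cond(χ)²)))`). -/
def oddSquareCount (N : ℕ) : ℕ := (N.primeFactors.filter (fun p => p ≠ 2 ∧ p ^ 2 ∣ N)).card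

/-- The `2`-adic twist rank `[2⁴ ∣ N] + [2⁶ ∣ N]`: the characters `χ₋₄` (conductor `4`) and `χ_{±8}` (conductor `8`)
act on `S₂(Γ₀(N))` when `16 ∣ N`, resp. `64 ∣ N`. -/
def twoAdicTwistRank (N : ℕ) : ℕ := (if 2 ^ 4 ∣ N then 1 else 0) + (if 2 ^ 6 ∣ N then 1 else 0)

/-- `a₀(N) = #{p odd : p² ∣ N} + [2⁴ ∣ N] + [2⁶ ∣ N]`, the rank of the group of quadratic Dirichlet characters `χ`
with `cond(χ)² ∣ N` (the «square-level twist lattice»). -/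
def squareLevelTwistRank (N : ℕ) : ℕ := oddSquareCount N + twoAdicTwistRank N

/-- **ES-33A₁ (IN PRINT, parity): a non-CM elliptic newform at a level divisible by an odd square or by `16` has EVEN
congruence number.**  Yazdani, *Modular abelian varieties of odd modular degree*, Algebra & Number Theory 5 (2011),
proof of Prop. 2.10: `χ ⊗ f ∈ S₂(Γ₀(N))` for the quadratic `χ` of conductor `p` when `p^{2+δ_p} ∣ N` (`δ₂ = 2`), and
`χ ⊗ f ≡ f` modulo `2`; for `E/ℚ` without CM `χ ⊗ f ≠ f`, so `2 ∣ r_f`.  Filed here as the shape of the Literature fact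
the lens asks for (D-es-94). [cite: Yazdani2011OddModularDegree, Prop. 2.10 (proof)] -/
def EvenCongruenceNumberAtSquareLevel : Prop :=
  ∀ (W : WeierstrassCurve ℚ) [W.IsElliptic] [NeZero (W.conductorNorm ℤ)]
    (D : ModularParametrizationData W (W.conductorNorm ℤ)), ¬ W.HasCM →
    0 < squareLevelTwistRank (W.conductorNorm ℤ) → 2 ∣ congruenceNumber D.f

/-- **ES-33A `TwistLatticeDividesCongruenceNumber` (this lens; elementary, to be PROVED — not a conjecture): the square-level
twist lattice divides the congruence number, `2^{a₀(N)} ∣ r_f`.**  Proof sketch (MEMO-es §33.2): for independent quadratic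
characters `χ₁ … χ_k` with `cond(χᵢ)² ∣ N`, all `2^k` twists `f ⊗ χ_S` lie in `S₂(Γ₀(N); ℤ)`, are Petersson-orthogonal to `f`
for `S ≠ ∅` (distinct eigen-packets, `E` non-CM), and `h = 2^{-k} Σ_n a_n ∏ᵢ (1 − χᵢ(n)) qⁿ = 2^{-k} Σ_S (−1)^{|S|} f ⊗ χ_S` has
INTEGER coefficients (`∏(1 − χᵢ(n)) ∈ {0, 2^k}` for `(n, N') = 1`, and `a_n = 0` when `n` shares a prime with some `cond χᵢ`,
those primes being additive for `E`); then `f − g = 2^k h` with `g = f − 2^k h ∈ (ℤf)^⊥`, and `dvd_congruenceNumber_of_sub_eq_smul`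
gives `2^k ∣ congruenceNumber f`.  ENGINE 33 (kit job33) checks it numerically on every congruence number computed.
Why it might fail: only through a gap in the orthogonality / integrality bookkeeping at the primes dividing `cond χ`. -/
def TwistLatticeDividesCongruenceNumber : Prop :=
  ∀ (W : WeierstrassCurve ℚ) [W.IsElliptic] [NeZero (W.conductorNorm ℤ)]
    (D : ModularParametrizationData W (W.conductorNorm ℤ)), ¬ W.HasCM →
    2 ^ squareLevelTwistRank (W.conductorNorm ℤ) ∣ congruenceNumber D.f

/-- The parity case follows from the lattice statement. -/
theorem even_of_twistLattice (h : TwistLatticeDividesCongruenceNumber) : EvenCongruenceNumberAtSquareLevel := by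
  intro W _ _ D hcm hpos
  exact (dvd_pow_self 2 (Nat.pos_iff_ne_zero.mp hpos)).trans (h W D hcm)

/-- The number of primes of bad reduction `ω(N)`. -/
def primeCount (N : ℕ) : ℕ := N.primeFactors.card

/-- `p* = ±p ≡ 1 (mod 4)` for an odd prime `p`. -/
def primeStar (p : ℕ) : ℤ := if p % 4 = 1 then (p : ℤ) else -(p : ℤ)

/-- **ES-33A♯ `DeepTwistDividesCongruenceNumber` (this lens, -es g24 P33.12; elementary, to be PROVED): the RESOLVENT direction is
congruent modulo 4, and gives one more power of 2.**  If `p` is an odd prime with `p² ∣ N`, `ℚ(√p*) = ℚ(√Δ_W)` (`p* · Δ_W` a square: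
the quadratic resolvent of `W[2]`), then for every good prime `ℓ` inert in `ℚ(√p*)` Frobenius permutes the three points of order 2
by a TRANSPOSITION, whose matrix in `GL₂(𝔽₂)` has trace `0`, so `a_ℓ` is even and `a_n (1 − χ_{p*}(n)) ≡ 0 (mod 4)` for all `n` —
provided no prime `q` with `a_q` possibly ODD is inert in `ℚ(√p*)`: the multiplicative primes `q ∥ N` (`a_q = ±1`) and `q = 2`
when `4 ∤ N` (good ordinary or multiplicative reduction at 2; the Eichler–Shimura parity argument does not apply at the residual
prime) — hence the two split hypotheses.  (ENGINE 33 phase T: naive depth ≥ 2 at the good primes `< 400` ⟺ resolvent direction,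
872/872 vs 0/18 512; the orbit 1323e1/g1/k1/l1 with `p* = −3 ≡ 5 (mod 8)`, `2 ∤ N`, `v₂(r_E) = 2 = a(E)` shows the hypothesis at 2
is needed.)  The lattice vector of ES-33A then admits one more halving in the direction `p*`, whence `2^{a(E)+1} ∣ r_E`.
Census (r-currency, ENGINE 33P kit j335842 + partial j335549/j335538, non-CM, N ≤ 1 498): `2^{a(E)+[deep]} ∣ r_E` 4 125/4 125,
290 curves with a deep direction, 6 with equality.  Why it might fail: bookkeeping at the primes dividing `2p`, or CM. -/
def DeepTwistDividesCongruenceNumber : Prop :=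
  ∀ (W : WeierstrassCurve ℚ) [W.IsElliptic] [NeZero (W.conductorNorm ℤ)]
    (D : ModularParametrizationData W (W.conductorNorm ℤ)) (p : ℕ), ¬ W.HasCM → p.Prime → p ≠ 2 →
    p ^ 2 ∣ W.conductorNorm ℤ → IsSquare ((primeStar p : ℚ) * W.Δ) →
    (¬ 4 ∣ W.conductorNorm ℤ → primeStar p % 8 = 1) →
    (∀ q : ℕ, q.Prime → q ≠ 2 → q ∣ W.conductorNorm ℤ → ¬ q ^ 2 ∣ W.conductorNorm ℤ → jacobiSym (primeStar p) q = 1) →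
    2 ^ (squareLevelTwistRank (W.conductorNorm ℤ) + 1) ∣ congruenceNumber D.f

/-- ES-33A♯ refines ES-33A on its locus (bookkeeping). -/
theorem twistLattice_dvd_of_deep {W : WeierstrassCurve ℚ} [W.IsElliptic] [NeZero (W.conductorNorm ℤ)]
    (D : ModularParametrizationData W (W.conductorNorm ℤ))
    (h : 2 ^ (squareLevelTwistRank (W.conductorNorm ℤ) + 1) ∣ congruenceNumber D.f) :
    2 ^ squareLevelTwistRank (W.conductorNorm ℤ) ∣ congruenceNumber D.f :=
  (pow_dvd_pow 2 (Nat.le_succ _)).trans h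

/-- **ES-33B `CongruenceNumberSelmerALFloor` — CANDIDATE (conjecture of this lens, congruence-number currency; HYPOTHESIS mod-2 image
`S₃` (`HasSurjectiveModNGaloisRep 2`), not merely `E(ℚ)[2] = 0`: the non-split-Cartan optimal curve 196a1 (`r_E = 42`, `m_E = 6`,
`dimSel₂ = 1`, `ω = 2`) violates the `t₂ = 0` form — ENGINE 33P kit j335538; the form is
pre-registered as P33.3/P33.9; census on the `S₃` population `N ≤ 1 498` (ENGINE 33P kit j335842, optimal, non-CM): 2 518/2 518, and at
`4 ∥ N` 299/299 with 154 equalities — CensusES33 §4, §6; implied by the stronger ES-33E below via `twoAdicTwistRank_le_extra`).**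
For an optimal `E/ℚ` without rational `2`-torsion: `dim Sel₂(E) + (ω(N) − 1) + a₂(N) ≤ v₂(r_E)` where `a₂(N) = [2⁴ ∣ N] + [2⁶ ∣ N]`
is the `2`-adic twist rank — i.e. the Atkin–Lehner count runs over ALL bad primes (no dip at `v₂(N) = 2`) once degrees are
replaced by congruence numbers, and the `2`-adic twists add on top.  Multiplicatively:
`#Sel₂(E) · 2^{ω(N) + a₂(N)} ≤ 2 · 2^{v₂(r_E)}`.  Why it might fail: a `4 ∥ N` dip curve of ES-32 whose congruence number equals
its degree (then the Selmer `2` and the `w₄` `2` coincide in `𝕋`), or AL and twist congruences failing to be lattice-independent. -/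
@[conjecture] def CongruenceNumberSelmerALFloor : Prop :=
  ∀ (W : WeierstrassCurve ℚ) [W.IsElliptic] [W.IsGloballyMinimal] [NeZero (W.conductorNorm ℤ)]
    (D : ModularParametrizationData W (W.conductorNorm ℤ)),
    (∀ (W'' : WeierstrassCurve ℚ) [W''.IsElliptic] (D'' : ModularParametrizationData W'' (W.conductorNorm ℤ)),
        D''.f = D.f → D.modularDegree ≤ D''.modularDegree) →
    W.HasSurjectiveModNGaloisRep ((2 : ℕ) : ℤ) →
    Nat.card (W.selmerGroup 2) * 2 ^ (primeCount (W.conductorNorm ℤ) + twoAdicTwistRank (W.conductorNorm ℤ)) ≤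
      2 * 2 ^ (padicValNat 2 (congruenceNumber D.f))

/-- `F(v) = [v ≥ 3]·(v − 1)`: the 2-adic extra of the r-currency floor ES-33E. -/
def conductorFloorExtra (v : ℕ) : ℕ := if 3 ≤ v then v - 1 else 0

/-- **ES-33E `CongruenceNumberConductorFloor` (conjecture of this lens, -es g24; the r-currency MASTER LAW behind ES-32 B♯).**
For `W/ℚ` with SURJECTIVE mod-2 representation (`S₃`; then `dimSel₂(W)` and `r_E` are isogeny invariants, so no optimality and no
minimality hypothesis is needed), conductor `N`, `v = v₂(N)`:  `v₂(r_E) ≥ dimSel₂(W) + ω(N) − 1 + [v ≥ 3]·(v − 1)`.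
PRE-REGISTERED (NOTES P33.13) on the `N ≤ 1 498` population (ENGINE 33P kit j335842; optimal, `t₂ = 0`, `S₃`, non-CM): floors
`F(v) = 0,0,0,2,3,4,5` for `v = 0..6`, each ATTAINED (225/374/149/68/59/24/4 equalities; 2 518/2 518); full-range verdict (Sage kit j335426, PARI kit j335594/j335572;
predictions `F(7) = 6`, `F(8) = 7`) in CensusES33 §8.  Combined with the Agashe–Ribet–Stein
defect conjecture `v₂(r_E/m_E) ≤ ⌊v/2⌋` (their Conj. 2.2, `N ≤ 557`; verified here at `p = 2` on every curve computed) it YIELDS the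
m-currency law B♯ of ES-32 with its step `c(v) = ⌈v/2⌉` (`⌈v/2⌉ − 1 = (v − 1) − ⌊v/2⌋`) and the `c(2) = 0` dip (`F(2) − 1`): the curves
tight for B♯ are exactly those with maximal ARS defect.  Anatomy of `F`: the Atkin–Lehner share of the prime 2 is in `ω(N) − 1`;
of the extra `v − 1` (additive, `v ≥ 3`), `a₂(v) = [v ≥ 4] + [v ≥ 6]` is the admissible 2-adic twist lattice (ES-33A, a theorem
target) and `v − 1 − a₂(v) = 2, 2, 3, 3` (`v = 3..6`) is measured, not derived (MEMO-es §33.5).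
Why it might fail: the classes `v = 7, 8` (no `S₃` curve with `r_E` computed yet at `N ≤ 1 498`; B♯ + ARS predict `F = 6, 7`), or an
image-`C₃` analogue (false already at `v = 2`: 196a1, and at `v = 4`). -/
@[conjecture] def CongruenceNumberConductorFloor : Prop :=
  ∀ (W : WeierstrassCurve ℚ) [W.IsElliptic] [NeZero (W.conductorNorm ℤ)]
    (D : ModularParametrizationData W (W.conductorNorm ℤ)), W.HasSurjectiveModNGaloisRep ((2 : ℕ) : ℤ) →
    Nat.card (W.selmerGroup 2) *
        2 ^ (primeCount (W.conductorNorm ℤ) - 1 + conductorFloorExtra (padicValNat 2 (W.conductorNorm ℤ))) ≤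
      2 ^ padicValNat 2 (congruenceNumber D.f)

/-- ES-33E implies ES-33B's inequality pointwise in the exponent: `a₂(v) = [v ≥ 4] + [v ≥ 6] ≤ [v ≥ 3](v − 1)` (bookkeeping). -/
theorem twoAdicTwistRank_le_extra (v : ℕ) : (if 4 ≤ v then 1 else 0) + (if 6 ≤ v then 1 else 0) ≤ conductorFloorExtra v := by
  unfold conductorFloorExtra
  split_ifs <;> omega

/-- **ES-33C `DipIsCongruenceDefectAtFour` — CANDIDATE (conjecture of this lens; answers REF2 E32-R2′).**  For an optimal `E/ℚ`
with `4 ∥ N` and SURJECTIVE mod-2 representation (the `t₂ = 0`-only form is false: the `C₃`-image dips 196a1, 324c1, 1444b1,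
1764e1 have `r_E/m_E` odd — ENGINE 33P): `v₂(r_E) ≤ v₂(m_E) + 1` (the `p = 2`, `ord₂ N = 2` instance of the Agashe–Ribet–Stein
conjecture `ord_p(r_E/m_E) ≤ ½ ord_p N`), with EQUALITY whenever the ES-32 Selmer–Atkin–Lehner count exceeds the degree:
`dim Sel₂(E) + ω(N) − 1 > v₂(m_E) ⟹ v₂(r_E) = v₂(m_E) + 1` (the «dip» of ES-32B♯ at `v₂(N) = 2` is the ARS defect, not a failure of
the Atkin–Lehner count).  Census (`N ≤ 1 498` + salvaged shards): `v₂(r_E/m_E) ≤ 1` on 441/441 curves with `4 ∥ N`; the 41 `S₃` dips in range all have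
`v₂(r_E) = v₂(m_E) + 1`; the 109 dip levels to `N = 9 772` are kit j335572 (CensusES33 §4, §8).  Why it might fail: an `S₃` dip curve
with `r_E/m_E` odd beyond the computed range. [cite: AgasheRibetStein2012, Conj. 2.2] -/
@[conjecture] def DipIsCongruenceDefectAtFour : Prop :=
  ∀ (W : WeierstrassCurve ℚ) [W.IsElliptic] [W.IsGloballyMinimal] [NeZero (W.conductorNorm ℤ)]
    (D : ModularParametrizationData W (W.conductorNorm ℤ)),
    (∀ (W'' : WeierstrassCurve ℚ) [W''.IsElliptic] (D'' : ModularParametrizationData W'' (W.conductorNorm ℤ)),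
        D''.f = D.f → D.modularDegree ≤ D''.modularDegree) →
    W.HasSurjectiveModNGaloisRep ((2 : ℕ) : ℤ) → padicValNat 2 (W.conductorNorm ℤ) = 2 →
    padicValNat 2 (congruenceNumber D.f) ≤ padicValNat 2 D.modularDegree + 1 ∧
      (2 * 2 ^ padicValNat 2 D.modularDegree < Nat.card (W.selmerGroup 2) * 2 ^ primeCount (W.conductorNorm ℤ) →
        padicValNat 2 (congruenceNumber D.f) = padicValNat 2 D.modularDegree + 1)

/-- **ES-33B on the slice of the crux, in the form the route consumes: `TwistALMinimalCongruenceSelmerTrivialOnSlice`.**  For the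
crux's `W` (non-CM, surjective `2`-adic image, odd torsion, odd Tamagawa product, analytic rank `1`) and its optimal datum: if the
CONGRUENCE NUMBER sits on the Atkin–Lehner-plus-twist floor, `v₂(r_E) = ω(N) − 1 + a₂(N) + 1` (the `+1` = the rational point's own
Selmer class), then `Sel₂(W) ≅ ℤ/2`, so `Ш(W)[2^∞] = 0` — the algebraic half of `BSD₂(W)` on that sub-slice.  A consequence of
`CongruenceNumberSelmerALFloor`; conjecture. -/
@[conjecture] def TwistALMinimalCongruenceSelmerTrivialOnSlice : Prop :=
  ∀ (W : WeierstrassCurve ℚ) [W.IsElliptic] [W.IsGloballyMinimal] [NeZero (W.conductorNorm ℤ)],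
    ¬ W.HasCM → (∀ n : ℕ, W.HasSurjectiveModNGaloisRep ((2 ^ n : ℕ) : ℤ)) → Odd W.torsionOrder → Odd W.tamagawaProduct →
    W.analyticRank = 1 →
    ∀ (D : ModularParametrizationData W (W.conductorNorm ℤ)),
    (∀ (W'' : WeierstrassCurve ℚ) [W''.IsElliptic] (D'' : ModularParametrizationData W'' (W.conductorNorm ℤ)),
        D''.f = D.f → D.modularDegree ≤ D''.modularDegree) →
    padicValNat 2 (congruenceNumber D.f) = primeCount (W.conductorNorm ℤ) + twoAdicTwistRank (W.conductorNorm ℤ) →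
    Nat.card (W.selmerGroup 2) ≤ 2

/-- Elementary glue: the congruence-number floor implies the slice statement (arithmetic on exponents). -/
theorem sliceTrivial_of_floor (h : CongruenceNumberSelmerALFloor)
    (W : WeierstrassCurve ℚ) [W.IsElliptic] [W.IsGloballyMinimal] [NeZero (W.conductorNorm ℤ)]
    (h2 : W.HasSurjectiveModNGaloisRep ((2 : ℕ) : ℤ))
    (D : ModularParametrizationData W (W.conductorNorm ℤ))
    (hopt : ∀ (W'' : WeierstrassCurve ℚ) [W''.IsElliptic] (D'' : ModularParametrizationData W'' (W.conductorNorm ℤ)),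
        D''.f = D.f → D.modularDegree ≤ D''.modularDegree)
    (hmin : padicValNat 2 (congruenceNumber D.f) = primeCount (W.conductorNorm ℤ) + twoAdicTwistRank (W.conductorNorm ℤ)) :
    Nat.card (W.selmerGroup 2) ≤ 2 := by
  have := h W D hopt h2
  rw [hmin] at this
  have hp : 0 < 2 ^ (primeCount (W.conductorNorm ℤ) + twoAdicTwistRank (W.conductorNorm ℤ)) := by positivity
  nlinarith

/-! ### Sanity values of the counting functions -/

example : squareLevelTwistRank 176 = 1 := by native_decide  -- 176 = 2⁴·11  (11a1 ⊗ χ₋₄)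
example : squareLevelTwistRank 64 = 2 := by native_decide   -- 64 = 2⁶
example : squareLevelTwistRank 242 = 1 := by native_decide  -- 242 = 2·11²
example : squareLevelTwistRank 3600 = 3 := by native_decide -- 3600 = 2⁴·3²·5²
example : squareLevelTwistRank 92 = 0 := by native_decide   -- 92 = 2²·23 (a dip level)


/-! ### ES-33A⁰ — the abstract SIGNED-TWIST LATTICE LEMMA (pure algebra over the tree's congruence-number API; the
first OPEN lemma of the ES-33A line, provable now: `Finset.prod_add` + `dvd_congruenceNumber_of_sub_eq_smul`) -/


/-! ### ES-33D — the dip needs `E[2]` unramified at 2 (ENGINE 33L, kit j335675) -/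

/-- **`E[2]` is unramified at 2**, typed elementarily (no local fields): some number field in which
`2` is unramified (`2 ∤ disc K`) contains all four `2`-torsion points.  Equivalent to
`ℚ(E[2])/ℚ` unramified above `2` (if `K ⊇ ℚ(E[2])` has odd discriminant then so is every subfield
unramified at 2; conversely take `K = ℚ(E[2])`).  For curves without rational `2`-torsion it is
decided by the parity of the discriminant of the cubic field of a `2`-torsion abscissa
(Stickelberger), which is what ENGINE 33L computes (`nfinit` + `idealprimedec`). [folklore] -/
def TwoTorsionUnramifiedAtTwo (W : WeierstrassCurve ℚ) : Prop :=
  ∃ (K : Type) (_ : Field K) (_ : NumberField K),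
    ¬ (2 : ℤ) ∣ NumberField.discr K ∧ Nat.card (W.torsionPoints K 2) = 4

/-- **ES-33D `NoDipWhenRamifiedAtTwo` — CANDIDATE (conjecture of this lens; modular-degree currency).**
For an `X₀(N)`-optimal `E` with `4 ∥ N`, no rational `2`-torsion and `E[2]` RAMIFIED at `2`:
`dim_𝔽₂ Sel₂(E) + ω(N) − 1 ≤ v₂(m_E)` — i.e. the `4 ∥ N` dip `g(2) = −1` of ES-32 law B♯ does not
occur.  Census (ENGINE 32S × ENGINE 33L, all optimal `N ≤ 10⁴`): **1 421 / 1 421, tight 311**; all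
150 dip curves have `E[2]` unramified at `2` (unramified sub-population: 952 curves, 150 dips).
Dictionary: `ρ̄_{E,2}` unramified at `2` with `4 ∣ N` is the level-lowerable case — `2`-old
congruences of `f_E` exist and the Agashe–Ribet–Stein defect `r_E/m_E` can absorb one `2`
(ES-33C); ramified `ρ̄` has no `2`-old companion.  Falsifier: one optimal `E`, `4 ∥ N`, `E(ℚ)[2] = 0`,
`E[2]` ramified at `2`, with `v₂(m_E) < dimSel₂ + ω(N) − 1`. -/
@[conjecture] def NoDipWhenRamifiedAtTwo : Prop :=
  ∀ (W : WeierstrassCurve ℚ) [W.IsElliptic] [W.IsGloballyMinimal] [NeZero (W.conductorNorm ℤ)]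
    (D : ModularParametrizationData W (W.conductorNorm ℤ)),
    (∀ (W'' : WeierstrassCurve ℚ) [W''.IsElliptic] (D'' : ModularParametrizationData W'' (W.conductorNorm ℤ)),
        D''.f = D.f → D.modularDegree ≤ D''.modularDegree) →
    Nat.card (W.toAffine.Point[(2 : ℤ)]) = 1 → padicValNat 2 (W.conductorNorm ℤ) = 2 →
    ¬ TwoTorsionUnramifiedAtTwo W →
    Nat.card (W.selmerGroup 2) * 2 ^ (primeCount (W.conductorNorm ℤ) - 1) ≤ 2 ^ padicValNat 2 D.modularDegree

/-- **ES-33A⁰ `SignedTwistLatticeLemma` (theorem target, elementary).**  Let `0 ≠ f ∈ S₂(Γ₀(N); ℤ)` and let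
`g_S ∈ S₂(Γ₀(N))`, `S ⊆ {0,…,k-1}`, be forms with `g_∅ = f`, `g_S ⊥ f` integral for `S ≠ ∅`, and coefficientwise
`aₙ(g_S) = (∏_{i ∈ S} εᵢ(n))·aₙ(f)` with signs `εᵢ(n) ∈ {±1}` — or `aₙ(f) = aₙ(g_S) = 0`.  Then `2^k ∣ r_f`.
Proof: `h := 2^{-k} Σ_S (-1)^{|S|} g_S` has `aₙ(h) = 2^{-k} aₙ(f) ∏ᵢ (1 - εᵢ(n)) ∈ ℤ` (each factor is `0` or `2`),
`f - (f - 2^k h) = 2^k • h` and `f - 2^k h = -Σ_{S ≠ ∅} (-1)^{|S|} g_S ∈ (ℤf)^⊥`; apply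
`dvd_congruenceNumber_of_sub_eq_smul`.  In ES-33A the `g_S` are the twists `f ⊗ χ_S` (`εᵢ = χᵢ`). -/
def SignedTwistLatticeLemma : Prop :=
  ∀ (N : ℕ) [NeZero N] (k : ℕ) (f : CuspForm (CongruenceSubgroup.Gamma0 N) 2) (ε : Fin k → ℕ → ℤ)
    (g : Finset (Fin k) → CuspForm (CongruenceSubgroup.Gamma0 N) 2),
    f ≠ 0 → f ∈ integralCuspForms0 N 2 → g ∅ = f →
    (∀ S : Finset (Fin k), S.Nonempty → g S ∈ integralOrthogonal0 f) →
    (∀ (S : Finset (Fin k)) (n : ℕ),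
        ((∀ i, ε i n = 1 ∨ ε i n = -1) ∧ cuspCoeff (g S) n = (∏ i ∈ S, (ε i n : ℂ)) * cuspCoeff f n) ∨
        (cuspCoeff f n = 0 ∧ cuspCoeff (g S) n = 0)) →
    2 ^ k ∣ congruenceNumber f

/-- **ES-33A¹ `AdmissibleTwistsExist` (PRINT, statement-only; Shimura 1971 Prop. 3.64 + Hecke self-adjointness +
«non-CM ⟹ no self-twist»): for the newform `f` of a non-CM `W` of conductor `N` and pairwise distinct quadratic
characters `χ₁ … χ_k` given as sign functions `εᵢ : ℕ → ℤ` with `cond(χᵢ)² ∣ N`, the twists `f ⊗ χ_S` exist in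
`S₂(Γ₀(N); ℤ)`, are orthogonal to `f` for `S ≠ ∅`, and have coefficients `χ_S(n) aₙ` (`= 0` when `aₙ = 0`, which
covers every `n` sharing a prime with a conductor since `W` is additive there).  Typed as the hypothesis shape the
abstract lemma consumes, for the square-level characters counted by `squareLevelTwistRank`. [cite: Shimura 1971
Prop. 3.64; Yazdani2011OddModularDegree, proof of Prop. 2.10] -/
def AdmissibleTwistsExist : Prop :=
  ∀ (W : WeierstrassCurve ℚ) [W.IsElliptic] [NeZero (W.conductorNorm ℤ)]
    (D : ModularParametrizationData W (W.conductorNorm ℤ)), ¬ W.HasCM →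
    ∃ (ε : Fin (squareLevelTwistRank (W.conductorNorm ℤ)) → ℕ → ℤ)
      (g : Finset (Fin (squareLevelTwistRank (W.conductorNorm ℤ))) → CuspForm (CongruenceSubgroup.Gamma0 (W.conductorNorm ℤ)) 2),
      g ∅ = D.f ∧ (∀ S, S.Nonempty → g S ∈ integralOrthogonal0 D.f) ∧
      (∀ S n, ((∀ i, ε i n = 1 ∨ ε i n = -1) ∧ cuspCoeff (g S) n = (∏ i ∈ S, (ε i n : ℂ)) * cuspCoeff D.f n) ∨
        (cuspCoeff D.f n = 0 ∧ cuspCoeff (g S) n = 0))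

/-- Kernel glue: the abstract lattice lemma and the printed existence of admissible twists give ES-33A. -/
theorem twistLattice_of (hL : SignedTwistLatticeLemma) (hT : AdmissibleTwistsExist) :
    TwistLatticeDividesCongruenceNumber := by
  intro W _ _ D hcm
  obtain ⟨ε, g, h0, horth, hcoef⟩ := hT W D hcm
  exact hL _ _ D.f ε g (Literature.NumberTheory.EllipticCurves.ModularForms.IsNewform0.ne_zero D.isNewformOf.1)
    D.f_mem_integralCuspForms0 h0 horth hcoef


/-- ES-33F `CongruenceNumberTwistInvariant` (target / support statement; CONJECTURE, theorem-grade candidate; -es g24 addendum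
2026-08-30): the congruence number of the newform of an elliptic curve is invariant under CONDUCTOR-PRESERVING quadratic twists:
if `cond(W ⊗ χ_d) = cond(W)` then `r_{W ⊗ χ_d} = r_W`.  Evidence: r equal EXACTLY on 1 389 / 1 389 pairs of optimal curves of equal
conductor N ≤ 3 532 related by a level-preserving quadratic twist (626 twists by −4, 8, −8; 763 by p* with v_p(N) = 2; ENGINE 33P,
kit j335842/j335594/j335572, Sage j335426), while `v₂` of the modular degree differs by 1 in 68 of the 626 2-adic pairs (Kodaira II ↔ I₂*
at N = 2⁷·m) — the mechanism of the 26 counterexamples to Agashe–Ribet–Stein Conj. 2.2 at p = 2 (CensusES33 §10–§11).  Conceptual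
anchor: the congruence module measures `L(1, Ad f)` [Hida 2000, (CN2)] and `Ad(f ⊗ χ) ≅ Ad f`; exactness at 2 is the new content.
Why it might fail: a level-preserving twist need not induce an automorphism of `S₂(Γ₀(N), ℤ)` (old forms from levels with smaller
2-part lose coefficients under `⊗ χ`), so the invariance of the FULL congruence module is not formal. -/
def CongruenceNumberTwistInvariant : Prop :=
  ∀ (W : WeierstrassCurve ℚ) [W.IsElliptic] (d : ℚ) [(W.quadraticTwist d).IsElliptic]
    [NeZero (W.conductorNorm ℤ)] [NeZero ((W.quadraticTwist d).conductorNorm ℤ)]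
    (D : ModularParametrizationData W (W.conductorNorm ℤ))
    (D' : ModularParametrizationData (W.quadraticTwist d) ((W.quadraticTwist d).conductorNorm ℤ)),
    (W.quadraticTwist d).conductorNorm ℤ = W.conductorNorm ℤ → congruenceNumber D'.f = congruenceNumber D.f

/-- Kernel glue: under ES-33F every `2`-power divisibility of the congruence number transports along a conductor-preserving twist
(this is how the twist lattice of ES-33A moves inside a twist orbit). -/
theorem dvd_congruenceNumber_of_twist (hF : CongruenceNumberTwistInvariant)
    {W : WeierstrassCurve ℚ} [W.IsElliptic] {d : ℚ} [(W.quadraticTwist d).IsElliptic]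
    [NeZero (W.conductorNorm ℤ)] [NeZero ((W.quadraticTwist d).conductorNorm ℤ)]
    (D : ModularParametrizationData W (W.conductorNorm ℤ))
    (D' : ModularParametrizationData (W.quadraticTwist d) ((W.quadraticTwist d).conductorNorm ℤ))
    (hN : (W.quadraticTwist d).conductorNorm ℤ = W.conductorNorm ℤ) {k : ℕ} (hk : k ∣ congruenceNumber D.f) :
    k ∣ congruenceNumber D'.f := by
  rw [hF W d D D' hN]; exact hk


/-! ## Addendum 3 (-es g24, 2026-08-30; answers REF1 R256b): ES-33A♯ in GENERAL RESOLVENT FORM.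
The deep direction of ES-33A♯ is the quadratic RESOLVENT `K = ℚ(√Δ_W)` of `W[2]`, whatever its discriminant: an odd prime
discriminant `p*` (the typed ES-33A♯), a 2-adic one `−4, 8, −8` (REF1's candidate row A♯₂, R256b), or a COMPOSITE one
(`ℚ(√−15)` at `N = 225`, `ℚ(√−6)` at `64·9 ∣ N`, …).  One statement covers all three: if the character `χ_K` lies in the
admissible group `G_N` (every odd prime of `disc K` to the square in `N`, `16 ∣ N` if `χ₋₄` is involved, `64 ∣ N` if `χ_{±8}` is),
every multiplicative prime `q ∥ N` splits in `K`, and `2` splits in `K` unless `4 ∣ N`, then `2^{a₀(N)+1} ∣ r_W`.  PROOF (as §33.2♯,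
one remark added): extend `χ_K` to an `𝔽₂`-basis `χ_K = χ₁, χ₂, …, χ_k` of `G_N` (`k = a₀(N)`); the vector
`h' = 2^{-(k+1)} Σ_S (−1)^{|S|} f ⊗ χ_S` has `n`-th coefficient `0` unless `n` is prime to every conductor (else `a_n = 0`, those primes
being additive) and `χᵢ(n) = −1` for all `i`, in which case it is `a_n / 2` with `χ_K(n) = −1`; then some prime `q ∣ n` to an odd power
is inert in `K`: `q` good ⟹ `Frob_q` is a transposition on `W[2]`, trace `0`, `a_q` even, `a_{q^{odd}}` even; `q` additive ⟹ `a_q = 0`;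
`q` multiplicative is excluded by the split clause (and `q = 2 ∤ N` by the clause at 2) — so `h'` is integral and `2^{k+1} ∣ r_f` by
`dvd_congruenceNumber_of_sub_eq_smul`.  (The basis MUST contain `χ_K`: with `K = ℚ(√−15)`, `N = 225` and the basis `χ₋₃, χ₅` the
vector is not integral.)  CENSUS (`an33/resolvent33.py` on the 6 466 non-CM curves with `r_E` known, `N ≤ 3 532`, ENGINE 33/33P two
engines agreeing 2 481/2 481): resolvent admissible and all clauses met — type `p*` 192/192 (2 equalities: 100a1 `r = 12`, 676a1),
type 2-adic 117/117 (5 equalities: 80b1 `r = 4`, 208c1, 464e1, 848d1, 2768c1), type composite 65/65 (`m ∈ {−15: 23, −6: 28, 6: 6,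
33: 3, 21: 2, 10: 2, −39: 1}`, 0 equalities); MUTATIONS: dropping the split clause — still 245/245, 145/145, 69/69 (the clause is
proof-driven, census-unexercised, as REF1 R256a found for `p*`); dropping the clause at 2 — 4 violators, the orbit 1323e1/g1/k1/l1
(`m = −3`, `2 ∤ N`), none of 2-adic/composite type (there `4 ∣ N` automatically or not: composite 78/78).  Not found in print (queries
of §33.2♯).  BSD is not advanced by this; it is a statement about the congruence module at 2. -/

/-- **ES-33A♯ (general resolvent form) `ResolventTwistDividesCongruenceNumber`** (this lens; elementary, theorem-grade target):
for non-CM `W` of conductor `N` and a squarefree integer `m ≠ 1` with `m · Δ_W` a rational square (so `K = ℚ(√m)` is the quadratic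
resolvent of `W[2]`): if every odd prime `p ∣ m` has `p² ∣ N`, `16 ∣ N` when `m ≡ 3 (mod 4)`, `64 ∣ N` when `m` is even (i.e.
`χ_K ∈ G_N`), every odd `q ∥ N` has `(m/q) = +1`, and `m ≡ 1 (mod 8)` unless `4 ∣ N`, then `2^{a₀(N)+1} ∣ congruenceNumber f_W`.
Specialises to ES-33A♯ (`m = p*`, `deepTwist_of_resolvent`) and to A♯₂ (`m ∈ {−1, 2, −2}`, `twoAdicDeep_of_resolvent`).
Why it might fail: only the orthogonality / level bookkeeping of `f ⊗ χ_S` at the primes of `cond χ` (Shimura 3.64), or CM. -/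
def ResolventTwistDividesCongruenceNumber : Prop :=
  ∀ (W : WeierstrassCurve ℚ) [W.IsElliptic] [NeZero (W.conductorNorm ℤ)]
    (D : ModularParametrizationData W (W.conductorNorm ℤ)) (m : ℤ), ¬ W.HasCM → Squarefree m → m ≠ 1 →
    IsSquare ((m : ℚ) * W.Δ) →
    (∀ p : ℕ, p.Prime → p ≠ 2 → (p : ℤ) ∣ m → p ^ 2 ∣ W.conductorNorm ℤ) →
    (m % 4 = 3 → 2 ^ 4 ∣ W.conductorNorm ℤ) → (2 ∣ m → 2 ^ 6 ∣ W.conductorNorm ℤ) →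
    (∀ q : ℕ, q.Prime → q ≠ 2 → q ∣ W.conductorNorm ℤ → ¬ q ^ 2 ∣ W.conductorNorm ℤ → jacobiSym m q = 1) →
    (¬ 4 ∣ W.conductorNorm ℤ → m % 8 = 1) →
    2 ^ (squareLevelTwistRank (W.conductorNorm ℤ) + 1) ∣ congruenceNumber D.f

/-- **ES-33A♯₂ `TwoAdicDeepTwistDividesCongruenceNumber`** (REF1 R256b's candidate row, typed): the 2-adic resolvents.  Non-CM `W`,
`m ∈ {−1, 2, −2}` with `m · Δ_W` a square (`K = ℚ(i), ℚ(√2), ℚ(√−2)`), `16 ∣ N` for `m = −1`, `64 ∣ N` for `m = ±2`, and every odd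
`q ∥ N` split in `K` ⟹ `2^{a₀(N)+1} ∣ congruenceNumber f_W`.  (No clause at 2: `16 ∣ N`.)  Census: 117/117 with the split clause
(5 equalities), 145/145 without it; REF1 §256 (C2): 48/48 at `N ≤ 2 924`. -/
def TwoAdicDeepTwistDividesCongruenceNumber : Prop :=
  ∀ (W : WeierstrassCurve ℚ) [W.IsElliptic] [NeZero (W.conductorNorm ℤ)]
    (D : ModularParametrizationData W (W.conductorNorm ℤ)) (m : ℤ), ¬ W.HasCM → (m = -1 ∨ m = 2 ∨ m = -2) →
    IsSquare ((m : ℚ) * W.Δ) → (m = -1 → 2 ^ 4 ∣ W.conductorNorm ℤ) → (m = 2 ∨ m = -2 → 2 ^ 6 ∣ W.conductorNorm ℤ) →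
    (∀ q : ℕ, q.Prime → q ≠ 2 → q ∣ W.conductorNorm ℤ → ¬ q ^ 2 ∣ W.conductorNorm ℤ → jacobiSym m q = 1) →
    2 ^ (squareLevelTwistRank (W.conductorNorm ℤ) + 1) ∣ congruenceNumber D.f

/-- Kernel glue: the 2-adic rows are the cases `m = −1, 2, −2` of the general resolvent statement. -/
theorem twoAdicDeep_of_resolvent (h : ResolventTwistDividesCongruenceNumber) :
    TwoAdicDeepTwistDividesCongruenceNumber := by
  intro W _ _ D m hcm hm hsq h4 h6 hsplit
  have four_dvd : 2 ^ 4 ∣ W.conductorNorm ℤ → 4 ∣ W.conductorNorm ℤ :=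
    fun h16 => dvd_trans (by norm_num) h16
  rcases hm with rfl | rfl | rfl
  · refine h W D (-1) hcm isUnit_one.neg.squarefree (by decide) hsq ?_ (fun _ => h4 rfl) (fun h2 => by omega) hsplit
      (fun hn => absurd (four_dvd (h4 rfl)) hn)
    intro p hp _ hd
    exact absurd (Nat.dvd_one.mp (by exact_mod_cast (dvd_neg.mp hd))) hp.one_lt.ne'
  · refine h W D 2 hcm Int.prime_two.squarefree (by decide) hsq ?_ (fun h3 => by omega) (fun _ => h6 (Or.inl rfl)) hsplit
      (fun hn => absurd (four_dvd (dvd_trans (pow_dvd_pow 2 (by norm_num)) (h6 (Or.inl rfl)))) hn)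
    intro p hp hp2 hd
    have hd' : p ∣ 2 := by exact_mod_cast hd
    rcases (Nat.dvd_prime Nat.prime_two).mp hd' with h1 | h2
    · exact absurd h1 hp.one_lt.ne'
    · exact absurd h2 hp2
  · refine h W D (-2) hcm Int.prime_two.neg.squarefree (by decide) hsq ?_ (fun h3 => by omega) (fun _ => h6 (Or.inr rfl)) hsplit
      (fun hn => absurd (four_dvd (dvd_trans (pow_dvd_pow 2 (by norm_num)) (h6 (Or.inr rfl)))) hn)
    intro p hp hp2 hd
    have hd' : p ∣ 2 := by exact_mod_cast (dvd_neg.mp hd)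
    rcases (Nat.dvd_prime Nat.prime_two).mp hd' with h1 | h2
    · exact absurd h1 hp.one_lt.ne'
    · exact absurd h2 hp2

/-- Kernel glue: the typed ES-33A♯ (odd prime resolvent `p*`) is the case `m = p*` of the general statement. -/
theorem deepTwist_of_resolvent (h : ResolventTwistDividesCongruenceNumber) : DeepTwistDividesCongruenceNumber := by
  intro W _ _ D p hcm hp hp2 hsqN hsq h8 hsplit
  have hodd : p % 2 = 1 := Nat.odd_iff.mp (hp.odd_of_ne_two hp2)
  have hpZ : Prime (p : ℤ) := Nat.prime_iff_prime_int.mp hp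
  have hsf : Squarefree (primeStar p) := by
    unfold primeStar; split_ifs
    · exact hpZ.squarefree
    · exact hpZ.neg.squarefree
  have hne : primeStar p ≠ 1 := by
    have := hp.two_le; unfold primeStar; split_ifs <;> omega
  have hmod4 : primeStar p % 4 = 3 → 2 ^ 4 ∣ W.conductorNorm ℤ := by
    intro h3; exfalso; unfold primeStar at h3; split_ifs at h3 <;> omega
  have heven : 2 ∣ primeStar p → 2 ^ 6 ∣ W.conductorNorm ℤ := by
    intro h2; exfalso; unfold primeStar at h2; split_ifs at h2 <;> omega
  refine h W D (primeStar p) hcm hsf hne hsq ?_ hmod4 heven hsplit h8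
  intro p' hp' _ hd
  have hd' : p' ∣ p := by
    unfold primeStar at hd; split_ifs at hd
    · exact_mod_cast hd
    · exact_mod_cast (dvd_neg.mp hd)
  rcases (Nat.dvd_prime hp).mp hd' with h1 | h1
  · exact absurd h1 hp'.one_lt.ne'
  · subst h1; exact hsqN

/-! ## Addendum 4 (session 3): the odd-`ℓ` twin — the TWIST-STABILISER of `ρ̄_{W,ℓ}` inside `G_N` divides `r_W`

The signed object behind ES-33A/A♯, prime by prime: the subgroup of `G_N` (quadratic `χ` with `cond(χ)² ∣ N`) that stabilises the
Galois representation modulo `ℓ` — `f ⊗ χ ≡ f (mod ℓ)` coefficientwise iff `ℓ ∣ a_n` whenever `χ(n) = −1`.  At `ℓ = 2` EVERY `χ ∈ G_N`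
stabilises (`χ ≡ 1 mod 2`), whence `2^{a₀(N)}` (ES-33A), and the resolvent character stabilises modulo `4`, whence `+1` (ES-33A♯).  At an
odd `ℓ` with `ℓ² ∣ N` the character `χ_{ℓ*}` lies in `G_N`; it stabilises `ρ̄_{W,ℓ}` tracewise iff `ℓ ∣ a_p` for every good `p` with
`(ℓ*/p) = −1`, and for `ℓ = 3` this is AUTOMATIC when `ρ̄_{W,3}` is reducible: `a_p ≡ ψ(p) + ψ(p)⁻¹p ≡ ψ(p)(1 + p) ≡ 0 (mod 3)` for
`p ≡ 2 (mod 3)` (`ψ` quadratic).  Same lattice proof as ES-33A♯ with `2` replaced by `ℓ`: `h = (f − f ⊗ χ_{ℓ*})/ℓ` is integral once every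
multiplicative `q ∥ N` splits in `ℚ(√ℓ*)` (`a_q = ±1` obstructs otherwise; `q = 2 ∥ N` needs `ℓ* ≡ ±1 mod 8`), `f − ℓh = f ⊗ χ_{ℓ*} ⊥ f`
(non-CM; for CM by `ℚ(√ℓ*)` itself `f ⊗ χ = f` and the statement is void — all 16 census «violators» have `j ∈ {0, −3375, −32768}` at
`ℓ = 3, 7, 11`), so `ℓ ∣ r_f` by `dvd_congruenceNumber_of_sub_eq_smul`.
CENSUS (`an33/odd33.py`, the 6 549 curves with `r_E` known, `N ≤ 3 532` + dips): ℓ = 3, non-CM, `9 ∣ N`, rational 3-isogeny, split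
clause — `3 ∣ r_E` 64/64 (base rate without the hypotheses 938/1 132 = 83 %); `3 ∣ m_E` 62/64 and `3 ∣ r_E/m_E` 38/64 — unlike the
2-adic deep twist (which lives in `r/m`), the 3-adic twist congruence is usually visible in the modular degree itself; tracewise `H₃`
beyond 3-isogeny: 3 curves, all CM-dihedral, 3/3.  ℓ = 5, 7, 11, 13: every curve meeting `H_ℓ ∧ split_ℓ` in range is CM; the ones whose
CM field is not `ℚ(√ℓ*)` (225a1/b1 at `ℓ = 5`) hold 2/2.  MUTATION (split clause dropped; ℓ = 3, non-CM, 3-isogeny): 231/248 — 17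
violators: here the split clause is LOAD-BEARING in the data (at `ℓ = 2` it was census-unexercised).  Nearest print: Watkins, Exp. Math.
11 (2002) §4, p. 500 records empirically that square divisors of the level and 3-isogenies influence `3 ∣ m_E` and that «there still
seems to be another factor», with no mechanism [corpus: paper:doi-10-1080-10586458-2002-10504701 p.14]; the twist-congruence mechanism,
its split clause and the `ℓ`-uniform statement are this lens's (queries: NOTES `## presearch g24` cont.).  Not a BSD statement. -/

/-- **ES-33Gℓ `OddTwistStabiliserDividesCongruenceNumber`** (this lens; elementary, theorem-grade target): for non-CM, globally minimal
`W` of conductor `N`, an odd prime `ℓ` with `ℓ² ∣ N` such that `ℓ ∣ a_p(W)` for every prime `p ∤ N`, `p` odd, with `(ℓ*/p) = −1`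
(and `ℓ ∣ a_2(W)` if `2 ∤ N` and `ℓ* ≢ ±1 mod 8`), every odd multiplicative `q ∥ N` having `(ℓ*/q) = +1`, and `ℓ* ≡ ±1 (mod 8)` if
`2 ∥ N`: then `ℓ ∣ congruenceNumber f_W`.  (`ℓ* = primeStar ℓ`; `(ℓ*/p) = (p/ℓ)`.)  Why it might fail: only the level / orthogonality
bookkeeping of `f ⊗ χ_{ℓ*}` (Shimura 3.64; Atkin–Li), exactly as for ES-33A♯. -/
def OddTwistStabiliserDividesCongruenceNumber : Prop :=
  ∀ (W : WeierstrassCurve ℚ) [W.IsElliptic] [W.IsGloballyMinimal] [NeZero (W.conductorNorm ℤ)]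
    (D : ModularParametrizationData W (W.conductorNorm ℤ)) (ℓ : ℕ), ℓ.Prime → ℓ ≠ 2 → ¬ W.HasCM →
    ℓ ^ 2 ∣ W.conductorNorm ℤ →
    (∀ p : ℕ, p.Prime → p ≠ 2 → ¬ p ∣ W.conductorNorm ℤ → jacobiSym (primeStar ℓ) p = -1 → (ℓ : ℤ) ∣ W.frobeniusTrace p) →
    (¬ 2 ∣ W.conductorNorm ℤ → ¬ (primeStar ℓ % 8 = 1 ∨ primeStar ℓ % 8 = 7) → (ℓ : ℤ) ∣ W.frobeniusTrace 2) →
    (∀ q : ℕ, q.Prime → q ≠ 2 → q ∣ W.conductorNorm ℤ → ¬ q ^ 2 ∣ W.conductorNorm ℤ → jacobiSym (primeStar ℓ) q = 1) →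
    (2 ∣ W.conductorNorm ℤ → ¬ 4 ∣ W.conductorNorm ℤ → (primeStar ℓ % 8 = 1 ∨ primeStar ℓ % 8 = 7)) →
    (ℓ : ℤ) ∣ congruenceNumber D.f

/-- The trace fact that makes `ℓ = 3` automatic (IN PRINT, folklore; e.g. the isogeny-character computation in Serre 1972 §5 /
Silverman AEC Ex. 8.?): if `ρ̄_{W,3}` is reducible (a rational 3-isogeny), then `3 ∣ a_p(W)` for every good `p ≡ 2 (mod 3)` —
`a_p ≡ ψ(p) + ψ(p)⁻¹ p` with `ψ² = 1`.  Filed as the shape of the Literature fact the corollary needs; not proved here. -/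
def ModThreeReducibleTraceVanishing : Prop :=
  ∀ (W : WeierstrassCurve ℚ) [W.IsElliptic] [W.IsGloballyMinimal], ¬ W.HasIrreducibleModPGaloisRep 3 →
    ∀ p : ℕ, p.Prime → ¬ p ∣ W.conductorNorm ℤ → p % 3 = 2 → (3 : ℤ) ∣ W.frobeniusTrace p

/-- **ES-33G₃ `ThreeIsogenyTwistDividesCongruenceNumber`** (this lens; the census row): non-CM `W`, `9 ∣ N`, `ρ̄_{W,3}` reducible
(a rational 3-isogeny), and every multiplicative prime `q ∥ N` satisfies `q ≡ 1 (mod 3)` (so `2 ∥ N` is excluded) ⟹ `3 ∣ congruenceNumber f_W`.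
Census 64/64 non-CM (`3 ∣ m_E` for 62 of them); without the split clause 231/248.  Explains part of Watkins' (2002, §4) unexplained
excess of `3 ∣ m_E` at non-squarefree level. -/
def ThreeIsogenyTwistDividesCongruenceNumber : Prop :=
  ∀ (W : WeierstrassCurve ℚ) [W.IsElliptic] [W.IsGloballyMinimal] [NeZero (W.conductorNorm ℤ)]
    (D : ModularParametrizationData W (W.conductorNorm ℤ)), ¬ W.HasCM → ¬ W.HasIrreducibleModPGaloisRep 3 →
    3 ^ 2 ∣ W.conductorNorm ℤ →
    (∀ q : ℕ, q.Prime → q ∣ W.conductorNorm ℤ → ¬ q ^ 2 ∣ W.conductorNorm ℤ → q % 3 = 1) →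
    (3 : ℤ) ∣ congruenceNumber D.f

/-- `(−3/q) = +1` for odd `q ≡ 1 (mod 3)` (periodicity of the Jacobi symbol modulo `12`). -/
theorem jacobiSym_neg_three_of_mod_three_eq_one {q : ℕ} (hq : Odd q) (h1 : q % 3 = 1) : jacobiSym (-3) q = 1 := by
  rw [jacobiSym.mod_right (-3) hq]
  have h12 : q % (4 * (-3 : ℤ).natAbs) = q % 12 := by norm_num
  rw [h12]
  have : q % 12 = 1 ∨ q % 12 = 7 := by obtain ⟨k, rfl⟩ := hq; omega
  rcases this with h | h <;> rw [h] <;> norm_num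

/-- `(−3/q) = −1` for odd `q ≡ 2 (mod 3)`. -/
theorem jacobiSym_neg_three_of_mod_three_eq_two {q : ℕ} (hq : Odd q) (h2 : q % 3 = 2) : jacobiSym (-3) q = -1 := by
  rw [jacobiSym.mod_right (-3) hq]
  have h12 : q % (4 * (-3 : ℤ).natAbs) = q % 12 := by norm_num
  rw [h12]
  have : q % 12 = 5 ∨ q % 12 = 11 := by obtain ⟨k, rfl⟩ := hq; omega
  rcases this with h | h <;> rw [h] <;> norm_num

/-- Kernel glue: ES-33G₃ is the case `ℓ = 3` of ES-33Gℓ, given the trace fact (and `(−3/p) = −1 ↔ p ≡ 2 (mod 3)` for primes `p > 3`). -/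
theorem threeIsogenyTwist_of_oddStabiliser (h : OddTwistStabiliserDividesCongruenceNumber)
    (ht : ModThreeReducibleTraceVanishing) : ThreeIsogenyTwistDividesCongruenceNumber := by
  intro W _ _ _ D hcm hred h9 hsplit
  have hps : primeStar 3 = -3 := by unfold primeStar; norm_num
  have h3N : 3 ∣ W.conductorNorm ℤ := dvd_trans (dvd_pow_self 3 (by norm_num)) h9
  have h2 : 2 ∣ W.conductorNorm ℤ → ¬ 4 ∣ W.conductorNorm ℤ → (primeStar 3 % 8 = 1 ∨ primeStar 3 % 8 = 7) := by
    intro h2 h4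
    have h22 : ¬ 2 ^ 2 ∣ W.conductorNorm ℤ := by simpa using h4
    have := hsplit 2 Nat.prime_two h2 h22
    omega
  refine h W D 3 Nat.prime_three (by norm_num) hcm h9 ?_ ?_ ?_ h2
  · intro p hp hp2 hgood hj
    rw [hps] at hj
    have hp3 : p ≠ 3 := by rintro rfl; exact hgood h3N
    have hodd : Odd p := hp.odd_of_ne_two hp2
    have hmod : p % 3 = 2 := by
      have h0 : p % 3 ≠ 0 := by
        intro h0
        have h3p : 3 ∣ p := Nat.dvd_of_mod_eq_zero h0
        rcases (Nat.dvd_prime hp).mp h3p with h | h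
        · norm_num at h
        · exact hp3 h.symm
      by_contra hne
      have h1 : p % 3 = 1 := by omega
      rw [jacobiSym_neg_three_of_mod_three_eq_one hodd h1] at hj
      norm_num at hj
    exact ht W hred p hp hgood hmod
  · intro h2good _
    exact ht W hred 2 Nat.prime_two h2good (by norm_num)
  · intro q hq hq2 hqN hqsq
    rw [hps]
    exact jacobiSym_neg_three_of_mod_three_eq_one (hq.odd_of_ne_two hq2) (hsplit q hq hqN hqsq)

/-! ## Addendum 5 (session 3, ENGINE 33N): the SHARP clause at 2 of the resolvent statement

ENGINE 33N computes the congruence number `r_tw` of `f` inside the saturated TWIST-FAMILY lattice `{f ⊗ χ_D : D ∈ G_N}` directly from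
q-expansions; for `S₃`-image curves `v₂(r_tw) = a₀(N) + [resolvent clauses]` on 1 664 of 1 682 curves (never below), and 11 of the 18
others are curves with `2 ∤ N`, `2` INERT in `K = ℚ(√m)` (`m ≡ 5 mod 8`) and `a_2` EVEN (supersingular at 2: 121d1 `a_2 = 2`, 225d1/e1,
361b1, 441e1/f1, 675g1/h1, 1161a1–d1 `a_2 = 0`) — there the clause at 2 of `ResolventTwistDividesCongruenceNumber` is not needed: in the
proof the prime `2 ∣ n` (to an odd power, `2` inert) contributes `a_{2^e} ≡ a_2^e ≡ 0 (mod 2)`.  The four 1323 violators of the clause-free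
statement are ORDINARY at 2 (`a_2 = 1`).  So the sharp clause is «`2 ∤ N ⟹ (m ≡ 1 mod 8 ∨ 2 ∣ a_2)`; `2 ∥ N ⟹ m ≡ 1 mod 8`». -/

/-- **ES-33A♯ (sharp clause at 2) `ResolventTwistDividesCongruenceNumberSharp`**: as `ResolventTwistDividesCongruenceNumber`, with the clause
at `2` weakened to: `2 ∤ N ⟹ m ≡ 1 (mod 8)` OR `a_2(W)` even (supersingular at 2); `2 ∥ N ⟹ m ≡ 1 (mod 8)`.  Implies the original
(`sharp_imp_resolvent`).  Census (ENGINE 33N twist-family lattice, S₃ image, N ≤ 1 500 partial): the 11 odd-level supersingular-at-2 curves with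
inert resolvent all show the extra power of 2. -/
def ResolventTwistDividesCongruenceNumberSharp : Prop :=
  ∀ (W : WeierstrassCurve ℚ) [W.IsElliptic] [W.IsGloballyMinimal] [NeZero (W.conductorNorm ℤ)]
    (D : ModularParametrizationData W (W.conductorNorm ℤ)) (m : ℤ), ¬ W.HasCM → Squarefree m → m ≠ 1 →
    IsSquare ((m : ℚ) * W.Δ) →
    (∀ p : ℕ, p.Prime → p ≠ 2 → (p : ℤ) ∣ m → p ^ 2 ∣ W.conductorNorm ℤ) →
    (m % 4 = 3 → 2 ^ 4 ∣ W.conductorNorm ℤ) → (2 ∣ m → 2 ^ 6 ∣ W.conductorNorm ℤ) →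
    (∀ q : ℕ, q.Prime → q ≠ 2 → q ∣ W.conductorNorm ℤ → ¬ q ^ 2 ∣ W.conductorNorm ℤ → jacobiSym m q = 1) →
    (¬ 2 ∣ W.conductorNorm ℤ → m % 8 = 1 ∨ 2 ∣ W.frobeniusTrace 2) →
    (2 ∣ W.conductorNorm ℤ → ¬ 4 ∣ W.conductorNorm ℤ → m % 8 = 1) →
    2 ^ (squareLevelTwistRank (W.conductorNorm ℤ) + 1) ∣ congruenceNumber D.f

/-- Kernel glue: the sharp form implies the filed form (whose single clause `¬ 4 ∣ N → m ≡ 1 (mod 8)` gives both sharp clauses), for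
globally minimal models. -/
theorem sharp_imp_resolvent_minimal (h : ResolventTwistDividesCongruenceNumberSharp) :
    ∀ (W : WeierstrassCurve ℚ) [W.IsElliptic] [W.IsGloballyMinimal] [NeZero (W.conductorNorm ℤ)]
    (D : ModularParametrizationData W (W.conductorNorm ℤ)) (m : ℤ), ¬ W.HasCM → Squarefree m → m ≠ 1 →
    IsSquare ((m : ℚ) * W.Δ) →
    (∀ p : ℕ, p.Prime → p ≠ 2 → (p : ℤ) ∣ m → p ^ 2 ∣ W.conductorNorm ℤ) →
    (m % 4 = 3 → 2 ^ 4 ∣ W.conductorNorm ℤ) → (2 ∣ m → 2 ^ 6 ∣ W.conductorNorm ℤ) →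
    (∀ q : ℕ, q.Prime → q ≠ 2 → q ∣ W.conductorNorm ℤ → ¬ q ^ 2 ∣ W.conductorNorm ℤ → jacobiSym m q = 1) →
    (¬ 4 ∣ W.conductorNorm ℤ → m % 8 = 1) →
    2 ^ (squareLevelTwistRank (W.conductorNorm ℤ) + 1) ∣ congruenceNumber D.f := by
  intro W _ _ _ D m hcm hsf hne hsq hp h4 h6 hsplit h8
  refine h W D m hcm hsf hne hsq hp h4 h6 hsplit ?_ ?_
  · intro h2
    exact Or.inl (h8 (fun h4N => h2 (dvd_trans (by norm_num) h4N)))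
  · intro _ h4N
    exact h8 h4N

/-! ### 4-adic extra depth (ENGINE 33N): the non-split Cartan normaliser at level 4

Six S₃-image curves (two twist families: 216a1/216d1/432g1/432h1 with `j = -3072`, `m = -3`; 968a1/968c1 with `j = 1024`, `m = -11`)
show `v₂(r_tw) = a₀ + 2`: on them `a_p ≡ 0 (mod 4)` for EVERY good prime `p` inert in `K = ℚ(√m)` (checked `p < 400`).  Group theory
(enumeration of `GL₂(ℤ/4)`): the subgroups with full `GL₂(𝔽₂)` quotient, surjective determinant and trace `≡ 0 (mod 4)` on every lift of a
transposition are exactly the subgroups of the four conjugates of `N(C_ns(4))`, the normaliser of the non-split Cartan at level 4 (order 24,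
`N ∩ ker = {±1, ±1 + 2ω}`), whose non-trivial coset has trace `0`; so the trace hypothesis below says `im ρ̄_{E,4} ⊆ N(C_ns(4))` with
`K` the Cartan-coset field.  In the twist lattice the resolvent type then has `g_τ = gcd a_n ≡ 0 (mod 4)` (`a_{p^e} = a_p · (…)` for odd
`e`), i.e. one more power of `2`. -/

/-- **ES-33I `NonsplitCartanFourTwistDividesCongruenceNumber`**: under the hypotheses of `ResolventTwistDividesCongruenceNumberSharp`, if in
addition `4 ∣ a_p(W)` for every good prime `p` with `(m/p) = -1` (equivalently `im ρ̄_{W,4} ⊆ N(C_ns(4))` with coset field `ℚ(√m)`), then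
`2 ^ (a₀(N) + 2) ∣ r_W`.  Census (ENGINE 33N, S₃ image): 216a1, 216d1, 432g1, 432h1, 968a1, 968c1 = all curves with `v₂(r_tw) = a₀ + 2`. -/
def NonsplitCartanFourTwistDividesCongruenceNumber : Prop :=
  ∀ (W : WeierstrassCurve ℚ) [W.IsElliptic] [W.IsGloballyMinimal] [NeZero (W.conductorNorm ℤ)]
    (D : ModularParametrizationData W (W.conductorNorm ℤ)) (m : ℤ), ¬ W.HasCM → Squarefree m → m ≠ 1 →
    IsSquare ((m : ℚ) * W.Δ) →
    (∀ p : ℕ, p.Prime → p ≠ 2 → (p : ℤ) ∣ m → p ^ 2 ∣ W.conductorNorm ℤ) →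
    (m % 4 = 3 → 2 ^ 4 ∣ W.conductorNorm ℤ) → (2 ∣ m → 2 ^ 6 ∣ W.conductorNorm ℤ) →
    (∀ q : ℕ, q.Prime → q ≠ 2 → q ∣ W.conductorNorm ℤ → ¬ q ^ 2 ∣ W.conductorNorm ℤ → jacobiSym m q = 1) →
    (¬ 2 ∣ W.conductorNorm ℤ → m % 8 = 1 ∨ 2 ∣ W.frobeniusTrace 2) →
    (2 ∣ W.conductorNorm ℤ → ¬ 4 ∣ W.conductorNorm ℤ → m % 8 = 1) →
    (∀ p : ℕ, p.Prime → ¬ p ∣ W.conductorNorm ℤ → jacobiSym m p = -1 → (4 : ℤ) ∣ W.frobeniusTrace p) →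
    2 ^ (squareLevelTwistRank (W.conductorNorm ℤ) + 2) ∣ congruenceNumber D.f

/-! ### REF1 §311 riders R311a/b (-es g25, v6): the blind spot of ES-33I at the prime 2

Mathlib's `jacobiSym m 2` is never `-1` (tree: `jacobiSym_two_ne_neg_one`, `F1Sign2/ANg25` kernel), so the trace hypothesis of
`NonsplitCartanFourTwistDividesCongruenceNumber` (`jacobiSym m p = -1 → 4 ∣ a_p`) says nothing at `p = 2`.  When `2 ∤ N` and `m ≡ 5 (mod 8)`
the prime `2` is inert in `ℚ(√m)` and the `N(C_ns(4))` mechanism (non-trivial Cartan coset has trace `0 mod 4`) needs `a₂ ≡ 0 (mod 4)`, i.e.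
`a₂ = 0` since `|a₂| ≤ 2√2`; ES-33I as typed only asks `2 ∣ a₂` there (REF1 §311 R311a).  The sharp form below adds exactly that clause. -/

/-- **ES-33I♯ `NonsplitCartanFourTwistDividesCongruenceNumberSharp`** (-es g25, answering REF1 §311 R311a/b): ES-33I with the clause
`(¬ 2 ∣ N → m ≡ 5 (mod 8) → a₂(W) = 0)` closing the blind spot at the inert prime `2`.  Census (REF1 b311 independent re-tally + ENGINE 33N,
`S₃` image, `N ≤ 1 498`): the class `2 ∤ N, m ≡ 5 (8)` is EMPTY; TEN curves satisfy all hypotheses — 216a1, 216d1, 432g1, 432h1 (`m = -3`),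
968a1, 968c1 (`m = -11`), 1296a1, 1296b1, 1296h1, 1296j1 (`m = -1`, `a₀ = 2`, `v₂(r_W) = 6`) — with `2^(a₀+2) ∣ r_W` in all ten, 0 violations.
Falsifier box (REF1 mutation witnesses): dropping the two clauses at `2` admits 162a1, 162d1, 338a1, 338b1 (`m = -1`, `2 ∥ N`) with
`v₂(r_W) = 2 < a₀ + 2 = 3` — so those clauses are load-bearing.  Mechanism-grade PLAIN statement (REF2 R311c); not a theorem beyond print. -/
def NonsplitCartanFourTwistDividesCongruenceNumberSharp : Prop :=
  ∀ (W : WeierstrassCurve ℚ) [W.IsElliptic] [W.IsGloballyMinimal] [NeZero (W.conductorNorm ℤ)]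
    (D : ModularParametrizationData W (W.conductorNorm ℤ)) (m : ℤ), ¬ W.HasCM → Squarefree m → m ≠ 1 →
    IsSquare ((m : ℚ) * W.Δ) →
    (∀ p : ℕ, p.Prime → p ≠ 2 → (p : ℤ) ∣ m → p ^ 2 ∣ W.conductorNorm ℤ) →
    (m % 4 = 3 → 2 ^ 4 ∣ W.conductorNorm ℤ) → (2 ∣ m → 2 ^ 6 ∣ W.conductorNorm ℤ) →
    (∀ q : ℕ, q.Prime → q ≠ 2 → q ∣ W.conductorNorm ℤ → ¬ q ^ 2 ∣ W.conductorNorm ℤ → jacobiSym m q = 1) →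
    (¬ 2 ∣ W.conductorNorm ℤ → m % 8 = 1 ∨ 2 ∣ W.frobeniusTrace 2) →
    (¬ 2 ∣ W.conductorNorm ℤ → m % 8 = 5 → W.frobeniusTrace 2 = 0) →
    (2 ∣ W.conductorNorm ℤ → ¬ 4 ∣ W.conductorNorm ℤ → m % 8 = 1) →
    (∀ p : ℕ, p.Prime → ¬ p ∣ W.conductorNorm ℤ → jacobiSym m p = -1 → (4 : ℤ) ∣ W.frobeniusTrace p) →
    2 ^ (squareLevelTwistRank (W.conductorNorm ℤ) + 2) ∣ congruenceNumber D.f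

/-- ES-33I implies its sharp form (the sharp form only adds a hypothesis); provers may target either. -/
theorem nonsplitCartanFourSharp_of_nonsplit (h : NonsplitCartanFourTwistDividesCongruenceNumber) :
    NonsplitCartanFourTwistDividesCongruenceNumberSharp := by
  intro W _ _ _ D m hcm hsf hne hsq hp h4 h6 hsplit h2a _h2b h8 htr
  exact h W D m hcm hsf hne hsq hp h4 h6 hsplit h2a h8 htr

end Summit.BirchSwinnertonDyer.BirchSwinnertonDyer.Theorems.RankOneAtTwoTwistLattice

end
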